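import Literature.Geometry.Kaehler.ComplexTorusAnalyticIteratedTranslatesProper
import Literature.Geometry.Kaehler.ComplexTorusAnalyticProperIntersectionTranslates
import HarnessLib

/-!
# Persistence of proper iterated intersections: small translates `Y ∩ ⋂_j (D_j − t_j)` approximate
# `Y ∩ ⋂_j (D_j − t⁰_j)` at its points of the expected dimension (Remmert for `k` translates)

Layer `Literature/Geometry/Kaehler`; lane `lit-hodgefound`, seat p07, programme «INTERSECTION NUMBERS ARE
POINT COUNTS», file 7 (the `k`-parameter form of `ComplexTorusAnalyticProperIntersectionTranslates`). Let
`X = E/Λ` be a complex torus of dimension `g`, `Y ⊆ X` closed analytic of pure dimension `d`,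
`Y₀, …, Y_{k−1} ⊆ X` closed analytic of pure dimensions `d_j`, `τ⁰ ∈ X^k`, and write
`Z(τ) = Y ∩ ⋂_j (Y_j − τ_j)`, `r = d + Σ_j d_j − k·g` for the expected dimension. In Fulton's dynamic
intersection ([Fulton1998, §11.1]; Example 11.4.5 for translates by a group acting transitively) the
components of `Z(τ⁰)` of the expected dimension are the "proper components", along which the
intersection multiplicity is positive ([Fulton1998, §7.1 Prop. 7.1 (a)]: "`1 ≤ i(Z; V₁·…·V_r; X)`").
Analytically this rests on the following PERSISTENCE statement, proved here:

* §2 **`ComplexTorus.eventually_nonempty_inter_iInter_translate`** — if `z ∈ Z(τ⁰)` and `Z(τ⁰)` has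
  dimension `≤ r` at `z` (every regular point of `Z(τ⁰)` near `z` has codimension `≥ g − r`), then for
  every neighbourhood `U` of `z` and all `τ ∈ X^k` near `τ⁰` the set `U ∩ Z(τ)` is non-empty. This is
  REMMERT'S OPEN MAPPING THEOREM ([Fischer1976, §3.9 Prop.]: a holomorphic map of a pure `m`-dimensional
  space to an `n`-manifold with fibre dimension `m − n` at `p` is open at `p`) for the iterated subtraction
  map `σ_k : Y × Y₀ × ⋯ × Y_{k−1} → X^k`, `σ_k(x, y) = (y_j − x)_j`, at `(z, (z + τ⁰_j)_j)`: the source has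
  pure dimension `d + Σ d_j`, the fibre `σ_k⁻¹(τ) ≅ Z(τ)` has dimension `≤ r = (d + Σ d_j) − k·g` at that
  point, so `σ_k((U ∩ Y) × ∏ Y_j)` is a neighbourhood of `τ⁰`. (On the universal cover: the linear case
  `SCV.image_inter_mem_nhds_of_section` of `AnalyticSetOpenProjection` for
  `A = π⁻¹Y × ∏_j π⁻¹Y_j ⊆ E × E^k`, the linear surjection `(u, v) ↦ (v_j − u)_j` and the small-diagonal
  parametrisation `x ↦ (x, (x)_j)` of its kernel; pushed down by the open map `π^k`.) Also at every point
  of a PROPER `Z(τ⁰)` (`…_of_hasPureDim`), the limit-set form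
  **`mem_closure_iUnion_inter_iInter_translate`** (`z ∈ cl(⋃_{j ≥ N} Z(τ_j))` for `τ_j → τ⁰`), and the
  converse containment `mem_inter_iInter_translate_of_forall_mem_closure_iUnion` (the limit set of
  `Z(τ_j)`, `τ_j → τ⁰`, lies in `Z(τ⁰)`, for closed `Y, Y_j`) — so for a proper `Z(τ⁰)` the limit set of
  `Z(τ_j)` along ANY `τ_j → τ⁰` is exactly `Z(τ⁰)` (`forall_mem_closure_iUnion_iff_of_hasPureDim`);
  [Chirka1989, §12.1 Prop., p. 139: "under small shifts of the sets `A_j` the point `a` splits into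
  `i_a(A₁, …, A_k)` points"].
* §1 (model space `E^k`, preliminaries) `SCV.isZeroSetAt_pi`, **`SCV.isRegPt_pi_of_pure`** — a product
  `∏_j A_j ⊆ E^k` of everywhere-analytic sets all of whose regular points have codimension `c_j` is
  everywhere analytic, and all its regular points have codimension `Σ_j c_j`
  (`dim ∏ A_j = Σ dim A_j`, [Chirka1989, §3.5, proof of Prop. 2]; induction on `k` through
  `SCV.isRegPt_prod_of_pure` and the linear isomorphism `E × E^k ≅ E^{k+1}`).
* §3 corollaries for a non-empty proper `Z(τ⁰)`: `eventually_inter_iInter_translate_nonempty_of_hasPureDim`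
  (`Z(τ) ≠ ∅` for `τ` near `τ⁰`) and **`eventually_hasPureDim_inter_iInter_translate`** (`Z(τ)` is
  non-empty AND proper of dimension `r` for `τ` near `τ⁰` — with the openness of properness,
  `ComplexTorusAnalyticIteratedTranslatesProper`).

Theorems only; no definitions, no named facts.

## References

* [Fulton1998] W. Fulton, *Intersection Theory*, 2nd ed., Springer 1998, §7.1 Prop. 7.1 (a), §11.1,
  Example 11.4.5.
* [Fischer1976] G. Fischer, *Complex Analytic Geometry*, LNM 538, Springer 1976, §3.2 Thm., §3.9 Prop.
  (held `book:fischer1976-complex-analytic-geometry`, PDF p0159, p0165–0166).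
* [Chirka1989] E. M. Chirka, *Complex Analytic Sets*, Kluwer 1989, §2.3, §3.5 Prop. 2 (p. 36), §12.1
  Prop. (p. 139), §15.5 (p. 202) (held `book:chirkand-complex-analytic-sets`, PDF p0047, p0151).
* [Lange2023AbelianVarietiesComplex] H. Lange, *Abelian Varieties over the Complex Numbers*, Springer
  2023, §1.1.4 (the covering `π : E → X`), §4.6.2 Lemma 4.6.4–4.6.5.
-/

noncomputable section

open scoped Manifold Topology Pointwise
open Set Function Filter Module
open Literature.Analysis.Complex.SCV (IsZeroSetAt)

namespace Literature.Geometry.Kaehler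

/-! ### §1 Model space: products `∏_j A_j ⊆ E^k` of analytic sets, their regular points -/

namespace SCV

variable {E : Type*} [NormedAddCommGroup E] [NormedSpace ℂ E]

/-- The whole space is cut out (by no equation) near every point. [folklore] -/
private theorem isZeroSetAt_univ₇ {V : Type*} [NormedAddCommGroup V] [NormedSpace ℂ V] (x : V) :
    IsZeroSetAt (univ : Set V) x :=
  ⟨univ, isOpen_univ, mem_univ _, 0, fun _ ↦ 0, differentiableOn_const _, by ext y; simp⟩

/-- **A product `∏_{j<k} A_j ⊆ E^k` of everywhere-analytic subsets `A_j ⊆ E` is everywhere analytic**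
(it is the finite intersection of the preimages `pr_j⁻¹(A_j)` under the coordinate projections).
[cite: Chirka1989, §2.1 item 4] -/
theorem isZeroSetAt_pi {k : ℕ} {A : Fin k → Set E} (hA : ∀ j x, IsZeroSetAt (A j) x)
    (x : Fin k → E) : IsZeroSetAt (Set.pi univ A) x := by
  classical
  have hpre : ∀ j, IsZeroSetAt {w : Fin k → E | w j ∈ A j} x := by
    intro j
    have h := isZeroSetAt_preimage_add_comp (A := A j) (a := (0 : E))
      (ContinuousLinearMap.proj (R := ℂ) (φ := fun _ : Fin k ↦ E) j) (w₀ := x)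
      (by simpa using hA j (x j))
    simpa only [zero_add, ContinuousLinearMap.proj_apply] using h
  have hfin : ∀ s : Finset (Fin k), IsZeroSetAt (⋂ j ∈ s, {w : Fin k → E | w j ∈ A j}) x := by
    intro s
    induction s using Finset.induction_on with
    | empty => simpa using isZeroSetAt_univ₇ x
    | insert j s hj ih =>
      rw [Finset.set_biInter_insert]
      exact (hpre j).inter ih
  have hset : Set.pi univ A = ⋂ j ∈ (Finset.univ : Finset (Fin k)), {w : Fin k → E | w j ∈ A j} := by
    ext w
    simp [Set.mem_pi]
  rw [hset]
  exact hfin Finset.univ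

/-- `univ ⊆ V` has all its points regular of codimension `0`. [folklore] -/
private theorem isRegPt_univ_zero {V : Type*} [NormedAddCommGroup V] [NormedSpace ℂ V] (x : V) :
    IsRegPt (univ : Set V) 0 x := by
  refine ⟨univ, isOpen_univ, mem_univ _, fun _ ↦ 0, differentiableOn_const _, by ext y; simp, ?_⟩
  intro w
  exact ⟨0, Subsingleton.elim _ _⟩

variable [FiniteDimensional ℂ E]

/-- **`dim ∏_j A_j = Σ_j dim A_j` at every regular point** (model space): if `A_j ⊆ E` (`j < k`) are
everywhere analytic and all regular points of `A_j` have codimension `c_j`, then all regular points of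
`∏_j A_j ⊆ E^k` have codimension `Σ_j c_j`. Induction on `k`: `E^{k+1} ≅ E × E^k` linearly, with
`∏_{j ≤ k} A_j ≅ A₀ × ∏_{j ≥ 1} A_j`, and the two-factor statement `SCV.isRegPt_prod_of_pure`.
[cite: Chirka1989, §3.5 (proof of Prop. 2), p. 36; §2.3] -/
theorem isRegPt_pi_of_pure :
    ∀ {k : ℕ} {A : Fin k → Set E} {c : Fin k → ℕ}, (∀ j x, IsZeroSetAt (A j) x) →
      (∀ j, ∀ x ∈ regLocus (A j), IsRegPt (A j) (c j) x) →
        ∀ x ∈ regLocus (Set.pi univ A), IsRegPt (Set.pi univ A) (∑ j, c j) x := by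
  intro k
  induction k with
  | zero =>
    intro A c hA hp x hx
    have hpi : Set.pi (univ : Set (Fin 0)) A = univ := by
      ext w
      simp [Set.mem_pi]
    rw [hpi, Finset.univ_eq_empty, Finset.sum_empty]
    exact isRegPt_univ_zero x
  | succ k ih =>
    intro A c hA hp x hx
    -- `E × E^k ≅ E^{k+1}`
    set e : (E × (Fin k → E)) ≃L[ℂ] (Fin (k + 1) → E) :=
      (Fin.consLinearEquiv ℂ (fun _ : Fin (k + 1) ↦ E)).toContinuousLinearEquiv with he_def
    have he : ∀ p : E × (Fin k → E), e p = Fin.cons p.1 p.2 := fun p ↦ rfl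
    set P : Set (E × (Fin k → E)) := A 0 ×ˢ Set.pi univ (fun j : Fin k ↦ A j.succ) with hP
    have hpre : e ⁻¹' Set.pi univ A = P := by
      ext ⟨a, w⟩
      simp only [mem_preimage, Set.mem_pi, mem_univ, forall_true_left, he, hP, mem_prod,
        Fin.forall_fin_succ, Fin.cons_zero, Fin.cons_succ]
    have hset : Set.pi univ A = e '' P := by
      rw [← hpre, image_preimage_eq _ e.surjective]
    -- purity of the two factors
    have h₁ : ∀ y ∈ regLocus (A 0), IsRegPt (A 0) (c 0) y := hp 0
    have h₂ : ∀ y ∈ regLocus (Set.pi univ (fun j : Fin k ↦ A j.succ)),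
        IsRegPt (Set.pi univ (fun j : Fin k ↦ A j.succ)) (∑ j : Fin k, c j.succ) y :=
      ih (A := fun j : Fin k ↦ A j.succ) (c := fun j : Fin k ↦ c j.succ) (fun j y ↦ hA j.succ y)
        (fun j y hy ↦ hp j.succ y hy)
    have hprod : ∀ y ∈ regLocus P, IsRegPt P (c 0 + ∑ j : Fin k, c j.succ) y :=
      isRegPt_prod_of_pure (fun y _ ↦ hA 0 y) (fun y _ ↦ isZeroSetAt_pi (fun j w ↦ hA j.succ w) y) h₁ h₂
    -- transport through `e`
    set y := e.symm x with hy
    have hxy : x = e y := (e.apply_symm_apply x).symm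
    have hyP : y ∈ regLocus P := by
      obtain ⟨hxA, q, hq⟩ := hx
      refine ⟨?_, q, ?_⟩
      · have : e y ∈ e '' P := by rw [← hxy, ← hset]; exact hxA
        obtain ⟨y', hy', hyy'⟩ := this
        rwa [← e.injective hyy']
      · have h := hq.image_equiv e.symm
        rwa [hset, ContinuousLinearEquiv.symm_image_image] at h
    have h := (hprod y hyP).image_equiv e
    rw [← hset, ← hxy] at h
    rwa [Fin.sum_univ_succ]

end SCV

/-! ### §2 Remmert's open mapping theorem for the iterated subtraction map: persistence -/

namespace ComplexTorus

open Literature.Geometry.Kaehler.SCV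

universe u

variable {ι : Type*} [Fintype ι] {E : Type u} [NormedAddCommGroup E] [NormedSpace ℂ E]
  [FiniteDimensional ℂ E] (Φ : (ι → ℝ) ≃L[ℝ] E)

/-- **`U ∩ Y ∩ ⋂_j (Y_j − τ_j) ≠ ∅` for all `τ` near `τ⁰`**, at a point `z ∈ Z(τ⁰) = Y ∩ ⋂_j (Y_j − τ⁰_j)`
where `Z(τ⁰)` has the expected dimension. Let `Y ⊆ X` be closed analytic of pure dimension `d`,
`Y_j ⊆ X` (`j < k`) closed analytic of pure dimensions `d_j`, `r + k·g = d + Σ_j d_j` (`r` the expected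
dimension), `z ∈ Z(τ⁰)`, and suppose all regular points of `Z(τ⁰)` near `z` have codimension `≥ g − r`
(`dim_z Z(τ⁰) ≤ r`, hence `= r` by [Chirka1989, §3.5 Prop. 2]). Then for every neighbourhood `U` of `z`,
for all `τ` near `τ⁰` in `X^k` there is `x ∈ U ∩ Y` with `x + τ_j ∈ Y_j` for all `j`. This is Remmert's
open mapping theorem ([Fischer1976, §3.9 Prop.]) for the iterated subtraction map
`σ_k(x, y) = (y_j − x)_j` on `Y × ∏_j Y_j` (pure dimension `d + Σ d_j`) at `(z, (z + τ⁰_j)_j)`, whose fibre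
`σ_k⁻¹(τ)` is the small-diagonal copy of `Z(τ)`: `σ_k((U ∩ Y) × ∏ Y_j)` is a neighbourhood of `τ⁰`
("under small shifts of the sets `A_j` the point `a` splits into `i_a(A₁, …, A_k)` points",
[Chirka1989, §12.1 Prop.]). (Proof on the universal cover: `SCV.image_inter_mem_nhds_of_section` for
`π⁻¹Y × ∏ π⁻¹Y_j ⊆ E × E^k`, the linear surjection `(u, v) ↦ (v_j − u)_j` and the diagonal section
`x ↦ (x, (x)_j)`, then the open map `π^k`.) [cite: Fischer1976, §3.9 Prop. and Cor. 2]
[cite: Fulton1998, §11.1 and Example 11.4.5] [cite: Chirka1989, §3.5 Prop. 2 (p. 36) and §12.1 Prop. (p. 139)] -/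
theorem eventually_nonempty_inter_iInter_translate {k d r : ℕ} {dD : Fin k → ℕ}
    {Y : Set (ComplexTorus Φ)} {D : Fin k → Set (ComplexTorus Φ)} (hY : HasPureDim 𝓘(ℂ, E) Y d)
    (hD : ∀ j, HasPureDim 𝓘(ℂ, E) (D j) (dD j)) (hr : r + k * finrank ℂ E = d + ∑ j, dD j)
    {z : ComplexTorus Φ} {τ₀ : Fin k → ComplexTorus Φ} (hz : z ∈ Y ∩ ⋂ j, (fun x ↦ x + τ₀ j) ⁻¹' D j)
    (hdim : ∀ᶠ x in 𝓝 z, x ∈ Y ∩ ⋂ j, (fun x ↦ x + τ₀ j) ⁻¹' D j →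
      ∀ q, IsRegularPointOfCodim 𝓘(ℂ, E) (Y ∩ ⋂ j, (fun x ↦ x + τ₀ j) ⁻¹' D j) q x →
        finrank ℂ E ≤ q + r)
    {U : Set (ComplexTorus Φ)} (hU : U ∈ 𝓝 z) :
    ∀ᶠ τ in 𝓝 τ₀, (U ∩ (Y ∩ ⋂ j, (fun x ↦ x + τ j) ⁻¹' D j)).Nonempty := by
  classical
  -- lift `z` and `τ⁰` to the universal cover
  obtain ⟨a, rfl⟩ := cover_surjective Φ z
  obtain ⟨b', hb'⟩ : ∃ b' : Fin k → E, (fun j ↦ cover Φ (b' j)) = τ₀ :=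
    ⟨fun j ↦ (cover_surjective Φ (τ₀ j)).choose, funext fun j ↦ (cover_surjective Φ (τ₀ j)).choose_spec⟩
  set b : Fin k → E := fun j ↦ a + b' j with hbdef
  -- the factors on the universal cover
  set A₁ : Set E := cover Φ ⁻¹' Y with hA₁def
  set AD : Fin k → Set E := fun j ↦ cover Φ ⁻¹' D j with hADdef
  have hA₁ : ∀ x, IsZeroSetAt A₁ x := isZeroSetAt_cover_preimage Φ hY.isAnalyticSet
  have hAD : ∀ j x, IsZeroSetAt (AD j) x := fun j ↦ isZeroSetAt_cover_preimage Φ (hD j).isAnalyticSet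
  have hp₁ := isRegPt_cover_preimage_of_hasPureDim Φ hY
  have hpD : ∀ j, ∀ x ∈ regLocus (AD j), IsRegPt (AD j) (finrank ℂ E - dD j) x := fun j ↦
    isRegPt_cover_preimage_of_hasPureDim Φ (hD j)
  have hd := hY.le_finrank
  have hdD : ∀ j, dD j ≤ finrank ℂ E := fun j ↦ (hD j).le_finrank
  -- the product `A = π⁻¹Y × ∏_j π⁻¹Y_j ⊆ E × E^k`
  set A : Set (E × (Fin k → E)) := A₁ ×ˢ Set.pi univ AD with hAdef
  have hA : ∀ x ∈ (univ : Set (E × (Fin k → E))), IsZeroSetAt A x := fun x _ ↦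
    (hA₁ x.1).prod (isZeroSetAt_pi hAD x.2)
  have hpure' : ∀ x ∈ regLocus A, IsRegPt A ((finrank ℂ E - d) + ∑ j, (finrank ℂ E - dD j)) x :=
    isRegPt_prod_of_pure (fun x _ ↦ hA₁ x) (fun x _ ↦ isZeroSetAt_pi hAD x) hp₁ (isRegPt_pi_of_pure hAD hpD)
  have hrankpi : finrank ℂ (Fin k → E) = k * finrank ℂ E := by
    rw [Module.finrank_pi_fintype, Finset.sum_const, Finset.card_univ, Fintype.card_fin, smul_eq_mul]
  have hrankV : finrank ℂ (E × (Fin k → E)) = finrank ℂ E + k * finrank ℂ E := by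
    rw [Module.finrank_prod, hrankpi]
  have hsumD : ∑ j, dD j ≤ k * finrank ℂ E := by
    calc ∑ j, dD j ≤ ∑ _j : Fin k, finrank ℂ E := Finset.sum_le_sum fun j _ ↦ hdD j
      _ = k * finrank ℂ E := by
        rw [Finset.sum_const, Finset.card_univ, Fintype.card_fin, smul_eq_mul]
  have hsumc : ∑ j, (finrank ℂ E - dD j) + ∑ j, dD j = k * finrank ℂ E := by
    rw [← Finset.sum_add_distrib, Finset.sum_congr rfl fun j _ ↦ Nat.sub_add_cancel (hdD j),
      Finset.sum_const, Finset.card_univ, Fintype.card_fin, smul_eq_mul]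
  have hm : d + ∑ j, dD j ≤ finrank ℂ (E × (Fin k → E)) := by rw [hrankV]; omega
  have hpure : ∀ x ∈ regLocus A, IsRegPt A (finrank ℂ (E × (Fin k → E)) - (d + ∑ j, dD j)) x := by
    have h : finrank ℂ (E × (Fin k → E)) - (d + ∑ j, dD j) =
        (finrank ℂ E - d) + ∑ j, (finrank ℂ E - dD j) := by rw [hrankV]; omega
    rw [h]
    exact hpure'
  have haA : ((a, b) : E × (Fin k → E)) ∈ A := by
    refine ⟨hz.1, fun j _ ↦ ?_⟩
    change cover Φ (a + b' j) ∈ D j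
    rw [cover_add, congrFun hb' j]
    exact mem_iInter.1 hz.2 j
  -- the iterated subtraction map and the small-diagonal parametrisation of its kernel
  set ℓ : E × (Fin k → E) →L[ℂ] (Fin k → E) :=
    ContinuousLinearMap.snd ℂ E (Fin k → E) -
      ContinuousLinearMap.pi fun _ : Fin k ↦ ContinuousLinearMap.fst ℂ E (Fin k → E) with hℓdef
  have hℓapply : ∀ (x : E × (Fin k → E)) (j : Fin k), ℓ x j = x.2 j - x.1 := fun x j ↦ rfl
  have hℓ : Function.Surjective ℓ := fun v ↦ ⟨(0, v), funext fun j ↦ by rw [hℓapply, sub_zero]⟩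
  set κ : E →L[ℂ] E × (Fin k → E) :=
    (ContinuousLinearMap.id ℂ E).prod (ContinuousLinearMap.pi fun _ : Fin k ↦ ContinuousLinearMap.id ℂ E)
    with hκdef
  have hκapply : ∀ v : E, κ v = (v, fun _ ↦ v) := fun v ↦ rfl
  have hκ : Function.Injective κ := fun v w h ↦ congrArg Prod.fst h
  have hκℓ : ∀ w, ℓ (κ w) = 0 := fun w ↦ funext fun j ↦ by rw [hκapply, hℓapply, sub_self]; rfl
  have hrank : finrank ℂ E + finrank ℂ (Fin k → E) = finrank ℂ (E × (Fin k → E)) :=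
    (Module.finrank_prod).symm
  have hr' : r + finrank ℂ (Fin k → E) = d + ∑ j, dD j := by rw [hrankpi]; exact hr
  -- the diagonal section of `A` at `(a, b)` is the translate of `π⁻¹ Z(τ⁰)`
  have hsecset : {w : E | (a, b) + κ w ∈ A} =
      {v : E | a + v ∈ cover Φ ⁻¹' (Y ∩ ⋂ j, (fun x ↦ x + τ₀ j) ⁻¹' D j)} := by
    ext v
    simp only [mem_setOf_eq, hκapply, Prod.mk_add_mk, hAdef, mem_prod, Set.mem_pi, mem_univ,
      forall_true_left, Pi.add_apply, mem_preimage, mem_inter_iff, mem_iInter, hA₁def, hADdef, hbdef]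
    refine and_congr Iff.rfl (forall_congr' fun j ↦ ?_)
    rw [show a + b' j + v = a + v + b' j by abel, cover_add _ (a + v), congrFun hb' j]
  have hcont : Continuous fun v : E ↦ cover Φ (a + v) :=
    (continuous_cover Φ).comp (continuous_const.add continuous_id)
  have htend : Tendsto (fun v : E ↦ cover Φ (a + v)) (𝓝 0) (𝓝 (cover Φ a)) := by
    have := hcont.tendsto 0
    rwa [add_zero] at this
  have hsec : ∀ᶠ w in 𝓝 (0 : E), (a, b) + κ w ∈ A → ∀ q, IsRegPt {w : E | (a, b) + κ w ∈ A} q w →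
      finrank ℂ E ≤ q + r := by
    rw [hsecset]
    filter_upwards [htend.eventually hdim] with v hv hvA q hq
    have hvA' : a + v ∈ cover Φ ⁻¹' (Y ∩ ⋂ j, (fun x ↦ x + τ₀ j) ⁻¹' D j) := by
      have : v ∈ {w : E | (a, b) + κ w ∈ A} := hvA
      rwa [hsecset] at this
    refine hv hvA' q ?_
    have h1 := isRegPt_preimage_add_iff.1 hq
    exact (isRegularPointOfCodim_cover_preimage_iff Φ (a + v)).1 (isRegularPointOfCodim_iff_isRegPt.2 h1)
  -- Remmert's open mapping theorem for `ℓ` on `A` at `(a, b)`, with the neighbourhood `π⁻¹U × E^k`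
  have hU' : (cover Φ ⁻¹' U) ×ˢ (univ : Set (Fin k → E)) ∈ 𝓝 ((a, b) : E × (Fin k → E)) :=
    prod_mem_nhds ((continuous_cover Φ).continuousAt.preimage_mem_nhds hU) univ_mem
  have hmain := SCV.image_inter_mem_nhds_of_section hℓ κ hκ hκℓ hrank isOpen_univ (subset_univ A) hA
    haA hm hpure hr' hsec hU'
  have hℓab : ℓ (a, b) = b' := funext fun j ↦ by rw [hℓapply]; exact add_sub_cancel_left a (b' j)
  rw [hℓab] at hmain
  -- push down by the open map `π^k`
  have hopen : IsOpenMap (cover Φ) := (isOpenQuotientMap_cover (Φ := Φ)).isOpenMap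
  set G : (Fin k → E) → (Fin k → ComplexTorus Φ) := Pi.map fun _ ↦ cover Φ with hGdef
  have hG : IsOpenMap G :=
    IsOpenMap.piMap (fun _ ↦ hopen) (Eventually.of_forall fun _ ↦ cover_surjective Φ)
  have hGb : G b' = τ₀ := hb'
  have h2 := hG.image_mem_nhds hmain
  rw [hGb] at h2
  filter_upwards [h2]
  rintro _ ⟨w, ⟨⟨u, v⟩, ⟨⟨hu, hv⟩, huU, -⟩, rfl⟩, rfl⟩
  refine ⟨cover Φ u, huU, hu, mem_iInter.2 fun j ↦ ?_⟩
  rw [mem_preimage]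
  change cover Φ u + cover Φ (ℓ (u, v) j) ∈ D j
  rw [hℓapply, ← cover_add, add_sub_cancel]
  exact hv j (mem_univ j)

/-- **Proper iterated intersections: `U ∩ Z(τ) ≠ ∅` for all `τ` near `τ⁰`, at every point of `Z(τ⁰)`**
— the previous theorem when `Z(τ⁰) = Y ∩ ⋂_j (Y_j − τ⁰_j)` has the expected pure dimension
`r = d + Σ d_j − k·g` (every regular point has codimension `g − r`). [cite: Fischer1976, §3.9 Prop. and Cor. 2]
[cite: Fulton1998, §7.1 Prop. 7.1 (a), §11.1 and Example 11.4.5] [cite: Chirka1989, §12.1 Prop., p. 139] -/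
theorem eventually_nonempty_inter_iInter_translate_of_hasPureDim {k d r : ℕ} {dD : Fin k → ℕ}
    {Y : Set (ComplexTorus Φ)} {D : Fin k → Set (ComplexTorus Φ)} (hY : HasPureDim 𝓘(ℂ, E) Y d)
    (hD : ∀ j, HasPureDim 𝓘(ℂ, E) (D j) (dD j)) (hr : r + k * finrank ℂ E = d + ∑ j, dD j)
    {τ₀ : Fin k → ComplexTorus Φ} (hI : HasPureDim 𝓘(ℂ, E) (Y ∩ ⋂ j, (fun x ↦ x + τ₀ j) ⁻¹' D j) r)
    {z : ComplexTorus Φ} (hz : z ∈ Y ∩ ⋂ j, (fun x ↦ x + τ₀ j) ⁻¹' D j)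
    {U : Set (ComplexTorus Φ)} (hU : U ∈ 𝓝 z) :
    ∀ᶠ τ in 𝓝 τ₀, (U ∩ (Y ∩ ⋂ j, (fun x ↦ x + τ j) ⁻¹' D j)).Nonempty := by
  refine eventually_nonempty_inter_iInter_translate Φ hY hD hr hz (Eventually.of_forall ?_) hU
  intro x hx q hq
  obtain ⟨c, hc, -, -, hreg⟩ := hI
  have h := (hreg x ⟨hx, q, hq⟩).codim_unique hx hq
  omega

/-- **Limit-set form: every point of `Z(τ⁰)` of the expected dimension is a limit point of `Z(τ_j)`,
`τ_j → τ⁰`.** Under the hypotheses of `eventually_nonempty_inter_iInter_translate`, for every sequence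
`τ_j → τ⁰` in `X^k` and every `N`, `z ∈ cl(⋃_{j ≥ N} Z(τ_j))` (the limit set of [Chirka1989, §15.5]
along the translates contains `z`). [cite: Fulton1998, §11.1 (the limit cycle is supported on the
proper components)] [cite: Fischer1976, §3.9 Prop.] [cite: Chirka1989, §15.5, p. 202] -/
theorem mem_closure_iUnion_inter_iInter_translate {k d r : ℕ} {dD : Fin k → ℕ}
    {Y : Set (ComplexTorus Φ)} {D : Fin k → Set (ComplexTorus Φ)} (hY : HasPureDim 𝓘(ℂ, E) Y d)
    (hD : ∀ j, HasPureDim 𝓘(ℂ, E) (D j) (dD j)) (hr : r + k * finrank ℂ E = d + ∑ j, dD j)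
    {z : ComplexTorus Φ} {τ₀ : Fin k → ComplexTorus Φ} (hz : z ∈ Y ∩ ⋂ j, (fun x ↦ x + τ₀ j) ⁻¹' D j)
    (hdim : ∀ᶠ x in 𝓝 z, x ∈ Y ∩ ⋂ j, (fun x ↦ x + τ₀ j) ⁻¹' D j →
      ∀ q, IsRegularPointOfCodim 𝓘(ℂ, E) (Y ∩ ⋂ j, (fun x ↦ x + τ₀ j) ⁻¹' D j) q x →
        finrank ℂ E ≤ q + r)
    {t : ℕ → Fin k → ComplexTorus Φ} (ht : Tendsto t atTop (𝓝 τ₀)) (N : ℕ) :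
    z ∈ closure (⋃ j ≥ N, Y ∩ ⋂ i, (fun x ↦ x + t j i) ⁻¹' D i) := by
  rw [mem_closure_iff_nhds]
  intro U hU
  have hev := ht.eventually (eventually_nonempty_inter_iInter_translate Φ hY hD hr hz hdim hU)
  obtain ⟨j, hj, hjN⟩ := (hev.and (eventually_ge_atTop N)).exists
  obtain ⟨x, hxU, hx⟩ := hj
  refine ⟨x, hxU, ?_⟩
  simp only [mem_iUnion, exists_prop]
  exact ⟨j, hjN, hx⟩

/-- **Limit-set form for proper intersections**: if `Z(τ⁰)` has the expected pure dimension `r`, then for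
`τ_j → τ⁰` every point of `Z(τ⁰)` lies in `cl(⋃_{j ≥ N} Z(τ_j))` for all `N`.
[cite: Fulton1998, §7.1 Prop. 7.1 (a) and §11.1] [cite: Fischer1976, §3.9 Prop.] [cite: Chirka1989, §15.5, p. 202] -/
theorem mem_closure_iUnion_inter_iInter_translate_of_hasPureDim {k d r : ℕ} {dD : Fin k → ℕ}
    {Y : Set (ComplexTorus Φ)} {D : Fin k → Set (ComplexTorus Φ)} (hY : HasPureDim 𝓘(ℂ, E) Y d)
    (hD : ∀ j, HasPureDim 𝓘(ℂ, E) (D j) (dD j)) (hr : r + k * finrank ℂ E = d + ∑ j, dD j)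
    {τ₀ : Fin k → ComplexTorus Φ} (hI : HasPureDim 𝓘(ℂ, E) (Y ∩ ⋂ j, (fun x ↦ x + τ₀ j) ⁻¹' D j) r)
    {z : ComplexTorus Φ} (hz : z ∈ Y ∩ ⋂ j, (fun x ↦ x + τ₀ j) ⁻¹' D j)
    {t : ℕ → Fin k → ComplexTorus Φ} (ht : Tendsto t atTop (𝓝 τ₀)) (N : ℕ) :
    z ∈ closure (⋃ j ≥ N, Y ∩ ⋂ i, (fun x ↦ x + t j i) ⁻¹' D i) := by
  refine mem_closure_iUnion_inter_iInter_translate Φ hY hD hr hz (Eventually.of_forall ?_) ht N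
  intro x hx q hq
  obtain ⟨c, hc, -, -, hreg⟩ := hI
  have h := (hreg x ⟨hx, q, hq⟩).codim_unique hx hq
  omega

omit [Fintype ι] [FiniteDimensional ℂ E] in
/-- **Limit points of `Z(τ_j)` with `τ_j → τ⁰` lie in `Z(τ⁰)`** (closed `Y, Y_j`): if `z` is, for every `N`,
in the closure of `⋃_{j ≥ N} (Y ∩ ⋂_i (Y_i − τ_{j,i}))`, then `z ∈ Y ∩ ⋂_i (Y_i − τ⁰_i)` (addition is
continuous: a neighbourhood `U × V` of `(z, τ⁰_i)` with `U + V` off `Y_i` eventually contains the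
`τ_{j,i}`). With the previous theorem: for a PROPER `Z(τ⁰)` the limit set of `Z(τ_j)` along any `τ_j → τ⁰`
is exactly `Z(τ⁰)`. [cite: Fulton1998, §11.1 (the limit set lies over `t = 0`)] [cite: Chirka1989, §15.5, p. 202] -/
theorem mem_inter_iInter_translate_of_forall_mem_closure_iUnion {k : ℕ} {Y : Set (ComplexTorus Φ)}
    {D : Fin k → Set (ComplexTorus Φ)} (hY : IsClosed Y) (hD : ∀ i, IsClosed (D i))
    {τ₀ : Fin k → ComplexTorus Φ} {t : ℕ → Fin k → ComplexTorus Φ} (ht : Tendsto t atTop (𝓝 τ₀))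
    {z : ComplexTorus Φ} (hz : ∀ N : ℕ, z ∈ closure (⋃ j ≥ N, Y ∩ ⋂ i, (fun x ↦ x + t j i) ⁻¹' D i)) :
    z ∈ Y ∩ ⋂ i, (fun x ↦ x + τ₀ i) ⁻¹' D i := by
  refine ⟨?_, mem_iInter.2 fun i ↦ ?_⟩
  · have h1 : closure (⋃ j ≥ (0 : ℕ), Y ∩ ⋂ i, (fun x ↦ x + t j i) ⁻¹' D i) ⊆ Y :=
      closure_minimal (iUnion₂_subset fun j _ ↦ inter_subset_left) hY
    exact h1 (hz 0)
  · rw [mem_preimage]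
    by_contra hzY
    have hopen : IsOpen ((fun w : ComplexTorus Φ × ComplexTorus Φ ↦ w.1 + w.2) ⁻¹' (D i)ᶜ) :=
      (hD i).isOpen_compl.preimage continuous_add
    have hmem : (z, τ₀ i) ∈ (fun w : ComplexTorus Φ × ComplexTorus Φ ↦ w.1 + w.2) ⁻¹' (D i)ᶜ := hzY
    obtain ⟨U, V, hU, hV, hzU, h0V, hUV⟩ := isOpen_prod_iff.1 hopen z (τ₀ i) hmem
    have hti : Tendsto (fun j ↦ t j i) atTop (𝓝 (τ₀ i)) := (continuous_apply i).continuousAt.tendsto.comp ht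
    obtain ⟨N, hN⟩ := eventually_atTop.1 (hti.eventually (hV.mem_nhds h0V))
    have hdisj : U ∩ (⋃ j ≥ N, Y ∩ ⋂ i, (fun x ↦ x + t j i) ⁻¹' D i) = ∅ := by
      refine eq_empty_of_forall_notMem fun x hx ↦ ?_
      obtain ⟨hxU, hx⟩ := hx
      simp only [mem_iUnion, mem_inter_iff, mem_iInter, mem_preimage, exists_prop] at hx
      obtain ⟨j, hj, -, hxD⟩ := hx
      exact hUV (mk_mem_prod hxU (hN j hj)) (hxD i)
    have hne := mem_closure_iff_nhds.1 (hz N) U (hU.mem_nhds hzU)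
    rw [hdisj] at hne
    exact Set.not_nonempty_empty hne

/-- **For a PROPER `Z(τ⁰)`, the limit set of `Z(τ_j)` along any `τ_j → τ⁰` is exactly `Z(τ⁰)`.**
[cite: Fulton1998, §11.1] [cite: Chirka1989, §12.1 Prop. (p. 139) and §15.5 (p. 202)] -/
theorem forall_mem_closure_iUnion_iff_of_hasPureDim {k d r : ℕ} {dD : Fin k → ℕ}
    {Y : Set (ComplexTorus Φ)} {D : Fin k → Set (ComplexTorus Φ)} (hY : HasPureDim 𝓘(ℂ, E) Y d)
    (hD : ∀ j, HasPureDim 𝓘(ℂ, E) (D j) (dD j)) (hr : r + k * finrank ℂ E = d + ∑ j, dD j)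
    {τ₀ : Fin k → ComplexTorus Φ} (hI : HasPureDim 𝓘(ℂ, E) (Y ∩ ⋂ j, (fun x ↦ x + τ₀ j) ⁻¹' D j) r)
    {t : ℕ → Fin k → ComplexTorus Φ} (ht : Tendsto t atTop (𝓝 τ₀)) (z : ComplexTorus Φ) :
    (∀ N : ℕ, z ∈ closure (⋃ j ≥ N, Y ∩ ⋂ i, (fun x ↦ x + t j i) ⁻¹' D i)) ↔
      z ∈ Y ∩ ⋂ j, (fun x ↦ x + τ₀ j) ⁻¹' D j :=
  ⟨mem_inter_iInter_translate_of_forall_mem_closure_iUnion Φ hY.isAnalyticSet.isClosed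
      (fun i ↦ (hD i).isAnalyticSet.isClosed) ht,
    fun hz ↦ mem_closure_iUnion_inter_iInter_translate_of_hasPureDim Φ hY hD hr hI hz ht⟩

/-! ### §3 Near a non-empty proper member, the iterated translates are non-empty and proper -/

/-- **A non-empty proper `Z(τ⁰)` has non-empty neighbours: `Z(τ) ≠ ∅` for all `τ` near `τ⁰`.**
[cite: Fulton1998, §11.1 and Example 11.4.5] [cite: Chirka1989, §12.1 Prop., p. 139] -/
theorem eventually_inter_iInter_translate_nonempty_of_hasPureDim {k d r : ℕ} {dD : Fin k → ℕ}
    {Y : Set (ComplexTorus Φ)} {D : Fin k → Set (ComplexTorus Φ)} (hY : HasPureDim 𝓘(ℂ, E) Y d)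
    (hD : ∀ j, HasPureDim 𝓘(ℂ, E) (D j) (dD j)) (hr : r + k * finrank ℂ E = d + ∑ j, dD j)
    {τ₀ : Fin k → ComplexTorus Φ} (hI : HasPureDim 𝓘(ℂ, E) (Y ∩ ⋂ j, (fun x ↦ x + τ₀ j) ⁻¹' D j) r) :
    ∀ᶠ τ in 𝓝 τ₀, (Y ∩ ⋂ j, (fun x ↦ x + τ j) ⁻¹' D j).Nonempty := by
  obtain ⟨z, hz⟩ := hI.nonempty
  filter_upwards [eventually_nonempty_inter_iInter_translate_of_hasPureDim Φ hY hD hr hI hz univ_mem]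
    with τ hτ
  simpa only [univ_inter] using hτ

/-- **Near a non-empty proper member the iterated translates are NON-EMPTY AND PROPER**: if `Z(τ⁰)` has the
expected pure dimension `r`, then so has `Z(τ)` for all `τ` near `τ⁰` (persistence gives `Z(τ) ≠ ∅`, the
openness of properness, `isOpen_setOf_inter_iInter_translate_eq_empty_or_hasPureDim`, the rest).
[cite: Fulton1998, §11.1] [cite: Chirka1989, §12.1 (p. 136) and Prop. (p. 139)]
[cite: Lange2023AbelianVarietiesComplex, §4.6.2 Lemma 4.6.4 and Lemma 4.6.5] -/
theorem eventually_hasPureDim_inter_iInter_translate {k d r : ℕ} {dD : Fin k → ℕ}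
    {Y : Set (ComplexTorus Φ)} {D : Fin k → Set (ComplexTorus Φ)} (hY : HasPureDim 𝓘(ℂ, E) Y d)
    (hD : ∀ j, HasPureDim 𝓘(ℂ, E) (D j) (dD j)) (hr : r + k * finrank ℂ E = d + ∑ j, dD j)
    {τ₀ : Fin k → ComplexTorus Φ} (hI : HasPureDim 𝓘(ℂ, E) (Y ∩ ⋂ j, (fun x ↦ x + τ₀ j) ⁻¹' D j) r) :
    ∀ᶠ τ in 𝓝 τ₀, HasPureDim 𝓘(ℂ, E) (Y ∩ ⋂ j, (fun x ↦ x + τ j) ⁻¹' D j) r := by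
  have hopen := isOpen_setOf_inter_iInter_translate_eq_empty_or_hasPureDim Φ hY hD hr
  filter_upwards [hopen.mem_nhds (Or.inr hI : τ₀ ∈ {τ : Fin k → ComplexTorus Φ |
      Y ∩ ⋂ j, (fun x ↦ x + τ j) ⁻¹' D j = ∅ ∨ HasPureDim 𝓘(ℂ, E) (Y ∩ ⋂ j, (fun x ↦ x + τ j) ⁻¹' D j) r}),
    eventually_inter_iInter_translate_nonempty_of_hasPureDim Φ hY hD hr hI] with τ hτ hne
  exact hτ.resolve_left hne.ne_empty

end ComplexTorus

end Literature.Geometry.Kaehler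

end
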